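import Summits.RiemannHypothesis.RiemannHypothesis.Theorems.WeilFormatCCinfRowCoeffBox
import Summits.RiemannHypothesis.RiemannHypothesis.Theorems.WeilFormatCCinfNodeMoments
import Literature.NumberTheory.LFunctions.YoshidaWindowGramTailJBox
import Literature.NumberTheory.LFunctions.YoshidaWindowGramEntryBox
import Literature.Analysis.ValidatedNumerics.BernoulliNumbersTable
import HarnessLib

/-!
# Format C, design C∞ (E2, data side): the ROW-INPUT producer — `CinfCoeff.RowInputs` from format-C special-value records

Route context: Fourier–Galerkin / Schur-complement certificates of Weil positivity on a window ("format C", C∞ door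
`weilPositivityOn_of_cinf_pipeline`; supporting stmt-RiemannHypothesis-0098; seat rh-explicit-weil-2, cell memo
`run/shared/lean/pub/rh-explicit/rh-explicit-weil-2/gen17/EMITTER-PHASE2.md` §K, §3 (c)).

The prime-row primitives of the C∞ door (`CinfPrimR.prowDataNearT_even`, `CinfPrimRO.prowDataNearT_odd`, the row remainders)
take per-row input boxes `X n : CinfCoeff.RowInputs` under the hypothesis `CinfCoeff.RowInputsValid S a n ν R c (X n)`
(`WeilFormatCCinfRowCoeffBox`).  This file PRODUCES those inputs from the objects a format-C rung already certifies by
`decide +kernel`: the window constants `C : Encl.Consts` (`Encl.ConstsValid`), a special-value table `tab : List Encl.IdxRec`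
(`Encl.TabValid` — for the C∞ rung at `a = 1` the high-precision table `CinfHP1.tab`, S = 2^300), the Bernoulli table
`MC.bernoulliTable42`, and the node moments `D_s(a) = Σ_k e^{−2a l_k} l_k^s` (`CinfCoeff.nodeMomentBox`):

* `CinfRowIn.s2Box` / `mem_s2Box` — `(e^{a/2} − e^{−a/2})² = polC · a / 4` from the constants record;
* `momList` / `mem_momList` — the list `[D_0, …, D_{2R+1}]` (an `Option`, `some` iff every `nodeMomentBox` succeeds);
* `ofRec` — the `RowInputs` of one record (`odd = false`: weight `1/(1+4ω²)`; `odd = true`: weight `ω/(1+4ω²)`), the mode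
  function `F_n` by `Encl.modeFBox` (`YoshidaWindowGramTailJBox`);
* ★ `valid_ofRec_even` / ★ `valid_ofRec_odd` — `RowInputsValid` from `OffValid` of the record (+ consts, moments, `ν ≤ 21`);
* ★ `valid_tab_even` / ★ `valid_tab_odd` — the families `n ↦ ofRec … (tget tab n)` resp. `ii ↦ ofRec … (tget tab (ii+1))`
  are valid below `B` from `Encl.TabValid S a ks N tab` (`B ≤ N` resp. `B + 1 ≤ N`) — exactly the `hX` of the PrimR/PrimRO claims.

Interval plumbing over landed evaluators; standard axioms; no RH claim.
-/

set_option autoImplicit false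
-- `Summit.RiemannHypothesis.RiemannHypothesis.…` is the layout-mandated namespace (summit = problem name).
set_option linter.dupNamespace false

open Finset Complex
open scoped Real ArithmeticFunction.vonMangoldt

namespace Summit.RiemannHypothesis.RiemannHypothesis.Theorems.WeilFormatC

namespace CinfRowIn

open Literature.NumberTheory.LFunctions Literature.NumberTheory.LFunctions.Yoshida1992 Literature.Analysis.SpecialFunctions
open Literature.Analysis.ValidatedNumerics Literature.Analysis.ValidatedNumerics.NumericsMP
open CinfCoeff (RowInputs RowInputsValid nodeMomentBox mem_nodeMomentBox)
open Encl (Consts ConstsValid IdxRec OffValid IdxValid TabValid tget modeFBox mem_modeFBox)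

variable {S : ℕ}

/-! ## Index-independent pieces -/

/-- Box of `s² = (e^{a/2} − e^{−a/2})²`, obtained as `polC · a / 4` from the constants record (`polC ∋ (4/a)s²`). -/
def s2Box (S : ℕ) (C : Consts) : MI := (C.polC.mul S C.A).divNat 4

/-- `s2Box ∋ (e^{a/2} − e^{−a/2})²` (`a ≠ 0`). -/
theorem mem_s2Box (hS : 0 < S) {a : ℝ} (ha : a ≠ 0) {ks : List PrimeLen} {C : Consts} (hC : ConstsValid S a ks C) :
    MI.mem S ((Real.exp (a / 2) - Real.exp (-(a / 2))) ^ 2) (s2Box S C) := by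
  have h := MI.mem_divNat (MI.mem_mul hS hC.polC hC.ha) (n := 4) (by norm_num)
  rw [s2Box]
  refine Encl.mem_of_eq h ?_
  push_cast
  field_simp

/-- The node-moment list `[D_0(a), …, D_{2R+1}(a)]` (`K` nodes kept, series parameters `Kser`, `kred`); `none` if a box fails. -/
def momList (S Kser kred : ℕ) (a : ℚ) (R K : ℕ) : Option (List MI) :=
  Encl.omap (fun s ↦ nodeMomentBox S Kser kred a s K) (List.range (2 * R + 2))

/-- `momList` encloses every node moment of order `≤ 2R+1`. -/
theorem mem_momList (hS : 0 < S) {Kser kred : ℕ} {a : ℚ} (ha : 0 < a) {R K : ℕ} {Dl : List MI}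
    (h : momList S Kser kred a R K = some Dl) :
    ∀ s, s ≤ 2 * R + 1 →
      MI.mem S (∑' k : ℕ, Real.exp (-(2 * (a : ℝ) * digammaNode k)) * digammaNode k ^ s) (Dl.getD s default) := by
  intro s hs
  obtain ⟨_, hi⟩ := Encl.omap_spec h
  have hsl : s < (List.range (2 * R + 2)).length := by simp; omega
  have e := hi s hsl
  rw [List.getD_eq_getElem?_getD, List.getElem?_range (by omega), Option.getD_some] at e
  exact mem_nodeMomentBox hS ha e

/-! ## The inputs of one record -/

/-- **Row inputs from a record**: `π`, `1/π`, `a/(2π)`, `a/π`, `a²/(4π²)` from the constants; `F_n` by `Encl.modeFBox`; the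
block weight `c` (`R.c` even, `R.om · R.c` odd); `s²`; the Bernoulli table; the node-moment list. -/
def ofRec (S : ℕ) (C : Consts) (S2 : MI) (Dl : List MI) (odd : Bool) (R : IdxRec) : RowInputs where
  P := C.P
  Pinv := C.invPi
  A2P := (C.A.mul S C.invPi).divNat 2
  AP := C.A.mul S C.invPi
  QQ := ((C.A.mul S C.invPi).divNat 2).sqr S
  Fi := modeFBox S C R
  Ci := if odd then R.om.mul S R.c else R.c
  S2 := S2
  bt := MC.bernoulliTable42
  Dl := Dl

variable {a : ℚ} {ks : List PrimeLen} {C : Consts} {S2 : MI} {Dl : List MI} {ν Rr : ℕ}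

/-- ★ **Validity, even weight**: the inputs of a record valid at the mode `n` are `RowInputsValid … n ν Rr (1/(1+4ω_n²))`. -/
theorem valid_ofRec_even (hS : 0 < S) (hks : PrimeData (a : ℝ) ks) (hC : ConstsValid S (a : ℝ) ks C)
    (hS2 : MI.mem S ((Real.exp ((a : ℝ) / 2) - Real.exp (-((a : ℝ) / 2))) ^ 2) S2)
    (hD : ∀ s, s ≤ 2 * Rr + 1 →
      MI.mem S (∑' k : ℕ, Real.exp (-(2 * (a : ℝ) * digammaNode k)) * digammaNode k ^ s) (Dl.getD s default))
    (hν : ν ≤ 21) {n : ℕ} {R : IdxRec} (hR : OffValid S (a : ℝ) ks (n : ℤ) R) :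
    RowInputsValid S a n ν Rr (1 / (1 + 4 * freq (a : ℝ) n ^ 2)) (ofRec S C S2 Dl false R) where
  hP := hC.pi
  hPinv := hC.invPi
  hA2P := by
    have h := MI.mem_divNat (MI.mem_mul hS hC.ha hC.invPi) (n := 2) (by norm_num)
    exact Encl.mem_of_eq h (by push_cast; ring)
  hAP := by
    have h := MI.mem_mul hS hC.ha hC.invPi
    exact Encl.mem_of_eq h (by ring)
  hQQ := by
    have h := MI.mem_sqr hS (MI.mem_divNat (MI.mem_mul hS hC.ha hC.invPi) (n := 2) (by norm_num))
    exact Encl.mem_of_eq h (by push_cast; ring)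
  hFi := by
    have h := mem_modeFBox hS hks hC hR
    simpa [Encl.modeF, ofRec] using h
  hCi := by simpa [ofRec] using hR.c
  hS2 := hS2
  hbt := fun k hk ↦ MC.bernoulliTable42_getD (by omega)
  hD := hD

/-- ★ **Validity, odd weight**: the inputs of a record valid at the mode `n` are `RowInputsValid … n ν Rr (ω_n/(1+4ω_n²))`. -/
theorem valid_ofRec_odd (hS : 0 < S) (hks : PrimeData (a : ℝ) ks) (hC : ConstsValid S (a : ℝ) ks C)
    (hS2 : MI.mem S ((Real.exp ((a : ℝ) / 2) - Real.exp (-((a : ℝ) / 2))) ^ 2) S2)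
    (hD : ∀ s, s ≤ 2 * Rr + 1 →
      MI.mem S (∑' k : ℕ, Real.exp (-(2 * (a : ℝ) * digammaNode k)) * digammaNode k ^ s) (Dl.getD s default))
    (hν : ν ≤ 21) {n : ℕ} {R : IdxRec} (hR : OffValid S (a : ℝ) ks (n : ℤ) R) :
    RowInputsValid S a n ν Rr (freq (a : ℝ) n / (1 + 4 * freq (a : ℝ) n ^ 2)) (ofRec S C S2 Dl true R) where
  hP := hC.pi
  hPinv := hC.invPi
  hA2P := by
    have h := MI.mem_divNat (MI.mem_mul hS hC.ha hC.invPi) (n := 2) (by norm_num)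
    exact Encl.mem_of_eq h (by push_cast; ring)
  hAP := by
    have h := MI.mem_mul hS hC.ha hC.invPi
    exact Encl.mem_of_eq h (by ring)
  hQQ := by
    have h := MI.mem_sqr hS (MI.mem_divNat (MI.mem_mul hS hC.ha hC.invPi) (n := 2) (by norm_num))
    exact Encl.mem_of_eq h (by push_cast; ring)
  hFi := by
    have h := mem_modeFBox hS hks hC hR
    simpa [Encl.modeF, ofRec] using h
  hCi := by
    have h := MI.mem_mul hS hR.om hR.c
    simp only [ofRec, if_true]
    exact Encl.mem_of_eq h (by ring)
  hS2 := hS2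
  hbt := fun k hk ↦ MC.bernoulliTable42_getD (by omega)
  hD := hD

/-! ## Families over a certified table -/

variable {N B : ℕ} {tab : List IdxRec}

/-- ★ **Even rows from a table**: `n ↦ ofRec … (tget tab n)` is valid for every `n < B ≤ N`. -/
theorem valid_tab_even (hS : 0 < S) (hks : PrimeData (a : ℝ) ks) (hC : ConstsValid S (a : ℝ) ks C)
    (hS2 : MI.mem S ((Real.exp ((a : ℝ) / 2) - Real.exp (-((a : ℝ) / 2))) ^ 2) S2)
    (hD : ∀ s, s ≤ 2 * Rr + 1 →
      MI.mem S (∑' k : ℕ, Real.exp (-(2 * (a : ℝ) * digammaNode k)) * digammaNode k ^ s) (Dl.getD s default))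
    (hν : ν ≤ 21) (htab : TabValid S (a : ℝ) ks N tab) (hB : B ≤ N) :
    ∀ n < B, RowInputsValid S a n ν Rr (1 / (1 + 4 * freq (a : ℝ) n ^ 2))
      ((fun n ↦ ofRec S C S2 Dl false (tget tab n)) n) :=
  fun n hn ↦ valid_ofRec_even hS hks hC hS2 hD hν (htab n (by omega)).1

/-- ★ **Odd rows from a table**: `ii ↦ ofRec … (tget tab (ii+1))` (kernel index `ii` ↔ mode `ii+1`) is valid for every
`ii < B`, `B + 1 ≤ N`. -/
theorem valid_tab_odd (hS : 0 < S) (hks : PrimeData (a : ℝ) ks) (hC : ConstsValid S (a : ℝ) ks C)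
    (hS2 : MI.mem S ((Real.exp ((a : ℝ) / 2) - Real.exp (-((a : ℝ) / 2))) ^ 2) S2)
    (hD : ∀ s, s ≤ 2 * Rr + 1 →
      MI.mem S (∑' k : ℕ, Real.exp (-(2 * (a : ℝ) * digammaNode k)) * digammaNode k ^ s) (Dl.getD s default))
    (hν : ν ≤ 21) (htab : TabValid S (a : ℝ) ks N tab) (hB : B + 1 ≤ N) :
    ∀ ii < B, RowInputsValid S a (ii + 1) ν Rr
      (freq (a : ℝ) ((ii + 1 : ℕ) : ℤ) / (1 + 4 * freq (a : ℝ) ((ii + 1 : ℕ) : ℤ) ^ 2))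
      ((fun ii ↦ ofRec S C S2 Dl true (tget tab (ii + 1))) ii) :=
  fun ii hii ↦ valid_ofRec_odd hS hks hC hS2 hD hν (htab (ii + 1) (by omega)).1

end CinfRowIn

end Summit.RiemannHypothesis.RiemannHypothesis.Theorems.WeilFormatC
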